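import Literature.Analysis.FluidPDE.ClassicalSolution
import Literature.Analysis.FluidPDE.LerayHopf
import Literature.Analysis.FluidPDE.SuitableWeak
import Literature.Analysis.FluidPDE.NSWave0
import HarnessLib

/-!
# The collapse-Reynolds ladder `X_C` of Type I exclusion statements

A DEFINITION file (no facts, nothing asserted): the parametric family of statements

  `CollapseReynoldsNoBlowup C` := "every classical solution `(u, p)` of the unforced Navier–Stokes
  system on `ℝ³ × [0, T)` (`ν > 0`, `T > 0`) which is Leray–Hopf on `[0, T)` from the rapidly
  decaying datum `u 0` and whose blow-up rate at `T` is at most Type I *of level `C`*,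
  `√(T − t) ‖u(t, x)‖ ≤ C √ν` for all `x` and all `t < T` close to `T`, extends smoothly past `T`",

indexed by the level `C : ℝ` (the *collapse Reynolds number* `√((T − t)/ν) ‖u(t)‖_∞`; the
normalisation `C √ν` makes the level scale-free).  The Type I rate `‖u(t)‖_∞ ≤ C (T − t)^{-1/2}` is
the rate singled out by Leray's lower bound `V(t) > A √(ν/(T − t))` at a time of irregularity
(Leray 1934, Acta Math. 63, §19 (3.8)–(3.9), p. 224 — read contrapositively, Leray's theorem is the
rung at his universal level `A`, the tree's `leray_blowup_rate_top` / route support `RungZero`) and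
called *type I* by Koch–Nadirashvili–Seregin–Šverák (Acta Math. 203 (2009) = arXiv:0709.3599, §1:
"a singularity … at time `T` is called type I if `sup_x |u(x,t)| ≤ C/√(T − t)` for some `C > 0`";
the tree's `IsTypeIBlowup`).

## References
* J. Leray, *Sur le mouvement d'un liquide visqueux emplissant l'espace*, Acta Math. 63 (1934),
  §19 (3.8)–(3.9), p. 224.  [bib: Leray1934]
* G. Koch, N. Nadirashvili, G. Seregin, V. Šverák, *Liouville theorems for the Navier–Stokes
  equations and applications*, Acta Math. 203 (2009), §1 and §6.  [bib: KochNadirashviliSereginSverak2009]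

The family is monotone (`collapseReynoldsNoBlowup_antitone`: a larger level is a stronger
statement), vacuous at negative levels (`collapseReynoldsNoBlowup_of_neg`), and its conjunction over
all positive levels is, verbatim, "no Type I blow-up for rapidly decaying Leray–Hopf classical
solutions" with the tree's `IsTypeIBlowup` (`forall_collapseReynoldsNoBlowup_iff`); the positive real
levels may be replaced by the integer levels `n + 1` (`forall_collapseReynoldsNoBlowup_iff_nat`).

All notions used are the tree's: `IsClassicalNSSolutionOn`, `IsLerayHopfOn` (`LerayHopf.lean`),
`HasRapidSpatialDecay` (`NSWave0.lean`), `IsTypeIBlowup` (`SuitableWeak.lean`),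
`HasSmoothExtensionPast` (`ClassicalSolution.lean`).  Deliberately NOT here: any claim that a rung
holds (rungs are problem-side statement items), and the level-`0` rung (`u ≡ 0` near `T`), which is
not asserted either way.
-/

open Set Filter Topology

namespace Literature.Analysis.FluidPDE

/-- **Rung `X_C` of the collapse-Reynolds ladder** (a definition; nothing is asserted).  For a level
`C : ℝ`: every classical solution `(u, p)` of unforced Navier–Stokes on `ℝ³ × [0, T)` with `0 < ν`,
`0 < T`, which is a Leray–Hopf solution on `[0, T)` from its datum `u 0`, whose datum decays rapidly,
and which blows up at `T` at most at the Type I rate OF LEVEL `C` — eventually as `t ↑ T`,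
`√(T − t) · ‖u t x‖ ≤ C · √ν` for every `x` (the level `C` bounds the dimensionless quantity
`√((T − t)/ν) ‖u(t)‖_∞`) — extends smoothly past `T`.  SOURCE OF THE SHAPE: Leray 1934,
Acta Math. 63, §19 (3.8)–(3.9) p. 224, "Un premier caractère des irrégularités": if a regular solution
becomes irregular at `T` then `V(t) > A √(ν/(T − t))`, `V(t) = max_x |u(x,t)|` — read
contrapositively, Leray's theorem IS the rung at his universal level `A` (so `∃ C > 0, X_C` is a
theorem, the tree's `leray_blowup_rate_top`); the rung at a general level `C` is the same
implication with `A` replaced by the parameter `C` (the "type I" rate of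
Koch–Nadirashvili–Seregin–Šverák 2009, §1: `sup_x |u(x,t)| ≤ C/√(T − t)`).  Which rungs hold
beyond Leray's level is NOT asserted here. [cite: Leray1934, §19 (3.9) p. 224]
[cite: KochNadirashviliSereginSverak2009, §1 (type I: sup_x |u(x,t)| ≤ C/√(T−t))] -/
def CollapseReynoldsNoBlowup (C : ℝ) : Prop :=
  ∀ (ν T : ℝ), 0 < ν → 0 < T →
    ∀ (u : ℝ → EuclideanSpace ℝ (Fin 3) → EuclideanSpace ℝ (Fin 3))
      (p : ℝ → EuclideanSpace ℝ (Fin 3) → ℝ),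
      IsClassicalNSSolutionOn (Set.Ico 0 T) ν 0 u p → IsLerayHopfOn T ν 0 (u 0) u →
        HasRapidSpatialDecay (u 0) →
          (∀ᶠ t in 𝓝[<] T, ∀ x, Real.sqrt (T - t) * ‖u t x‖ ≤ C * Real.sqrt ν) →
            HasSmoothExtensionPast ν 0 u T

/-- Monotonicity of the ladder in the level: if `C ≤ C'` then rung `C'` implies rung `C` (a solution
of level `C` is of level `C'`; bookkeeping on Leray's rate (3.9) with a parameter in place of `A`).
[cite: Leray1934, §19 (3.9) p. 224] -/
theorem CollapseReynoldsNoBlowup.anti {C C' : ℝ} (hCC' : C ≤ C') (h : CollapseReynoldsNoBlowup C') :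
    CollapseReynoldsNoBlowup C := by
  intro ν T hν hT u p hcl hLH hdec hrate
  refine h ν T hν hT u p hcl hLH hdec (hrate.mono fun t ht x => (ht x).trans ?_)
  exact mul_le_mul_of_nonneg_right hCC' (Real.sqrt_nonneg ν)

/-- The ladder `C ↦ X_C` is antitone: larger levels are stronger statements (bookkeeping on
Leray's rate (3.9) with a parameter in place of `A`). [cite: Leray1934, §19 (3.9) p. 224] -/
theorem collapseReynoldsNoBlowup_antitone : Antitone CollapseReynoldsNoBlowup :=
  fun _ _ hCC' h => h.anti hCC'

/-- Negative levels are vacuous rungs: `√(T − t) ‖u t x‖ ≤ C √ν < 0` is impossible, and the filter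
`𝓝[<] T` is nontrivial, so the rate hypothesis cannot hold eventually (bookkeeping on Leray's
rate (3.9): only positive levels are meaningful). [cite: Leray1934, §19 (3.9) p. 224] -/
theorem collapseReynoldsNoBlowup_of_neg {C : ℝ} (hC : C < 0) : CollapseReynoldsNoBlowup C := by
  intro ν T hν hT u p hcl hLH hdec hrate
  exfalso
  have hneg : C * Real.sqrt ν < 0 := mul_neg_of_neg_of_pos hC (Real.sqrt_pos.2 hν)
  have hfalse : ∀ᶠ t in 𝓝[<] T, False := hrate.mono fun t ht => by
    have h0 : 0 ≤ Real.sqrt (T - t) * ‖u t 0‖ := mul_nonneg (Real.sqrt_nonneg _) (norm_nonneg _)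
    exact absurd ((h0.trans (ht 0)).trans_lt hneg) (lt_irrefl 0)
  obtain ⟨_, h⟩ := hfalse.exists
  exact h

/-- A level-`C` rate is a type I rate in the sense of KNSS 2009 §1: eventually
`‖u t x‖ ≤ (C √ν)/√(T − t)`. [cite: KochNadirashviliSereginSverak2009, §1 (type I: sup_x |u(x,t)| ≤ C/√(T−t))] -/
theorem isTypeIBlowup_of_level {u : ℝ → EuclideanSpace ℝ (Fin 3) → EuclideanSpace ℝ (Fin 3)}
    {T C ν : ℝ}
    (hrate : ∀ᶠ t in 𝓝[<] T, ∀ x, Real.sqrt (T - t) * ‖u t x‖ ≤ C * Real.sqrt ν) :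
    IsTypeIBlowup u T := by
  refine ⟨C * Real.sqrt ν, ?_⟩
  filter_upwards [hrate, eventually_mem_nhdsWithin] with t ht htT x
  have hpos : 0 < Real.sqrt (T - t) := Real.sqrt_pos.2 (sub_pos.2 htT)
  rw [le_div_iff₀ hpos, mul_comm]
  exact ht x

/-- A type I rate in the sense of KNSS 2009 §1 (`sup_x |u(x,t)| ≤ C/√(T − t)` near `T`) is a
level-`C'` rate for some positive level `C'` (given `0 < ν`; `C' = max(C,1)/√ν`). [cite: KochNadirashviliSereginSverak2009, §1 (type I: sup_x |u(x,t)| ≤ C/√(T−t))] -/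
theorem IsTypeIBlowup.exists_level {u : ℝ → EuclideanSpace ℝ (Fin 3) → EuclideanSpace ℝ (Fin 3)}
    {T ν : ℝ} (hν : 0 < ν) (hI : IsTypeIBlowup u T) :
    ∃ C' : ℝ, 0 < C' ∧ ∀ᶠ t in 𝓝[<] T, ∀ x, Real.sqrt (T - t) * ‖u t x‖ ≤ C' * Real.sqrt ν := by
  obtain ⟨C, hC⟩ := hI
  have hsν : 0 < Real.sqrt ν := Real.sqrt_pos.2 hν
  refine ⟨max C 1 / Real.sqrt ν, div_pos (lt_of_lt_of_le one_pos (le_max_right _ _)) hsν, ?_⟩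
  filter_upwards [hC, eventually_mem_nhdsWithin] with t ht htT x
  have hpos : 0 < Real.sqrt (T - t) := Real.sqrt_pos.2 (sub_pos.2 htT)
  have h1 : Real.sqrt (T - t) * ‖u t x‖ ≤ C := by
    have := mul_le_mul_of_nonneg_left (ht x) hpos.le
    rwa [mul_div_cancel₀ C hpos.ne'] at this
  calc Real.sqrt (T - t) * ‖u t x‖ ≤ C := h1
    _ ≤ max C 1 := le_max_left _ _
    _ = max C 1 / Real.sqrt ν * Real.sqrt ν := (div_mul_cancel₀ _ hsν.ne').symm

/-- **The top of the ladder.**  The conjunction of all positive rungs is, verbatim, the statement "no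
Type I blow-up for Clay data": every rapidly-decaying-datum Leray–Hopf classical solution on
`ℝ³ × [0, T)` blowing up at most at the Type I rate at `T` (`IsTypeIBlowup u T`) extends smoothly
past `T` — the equivalence is bookkeeping between Leray's normalised rate (3.9) and the type I
rate of KNSS 2009 §1. [cite: KochNadirashviliSereginSverak2009, §1 (type I: sup_x |u(x,t)| ≤ C/√(T−t))]
[cite: Leray1934, §19 (3.9) p. 224] -/
theorem forall_collapseReynoldsNoBlowup_iff :
    (∀ C : ℝ, 0 < C → CollapseReynoldsNoBlowup C) ↔
      ∀ (ν T : ℝ), 0 < ν → 0 < T →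
        ∀ (u : ℝ → EuclideanSpace ℝ (Fin 3) → EuclideanSpace ℝ (Fin 3))
          (p : ℝ → EuclideanSpace ℝ (Fin 3) → ℝ),
          IsClassicalNSSolutionOn (Set.Ico 0 T) ν 0 u p → IsLerayHopfOn T ν 0 (u 0) u →
            HasRapidSpatialDecay (u 0) → IsTypeIBlowup u T → HasSmoothExtensionPast ν 0 u T := by
  constructor
  · intro h ν T hν hT u p hcl hLH hdec hI
    obtain ⟨C', hC', hrate⟩ := hI.exists_level hν
    exact h C' hC' ν T hν hT u p hcl hLH hdec hrate
  · intro h C _ ν T hν hT u p hcl hLH hdec hrate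
    exact h ν T hν hT u p hcl hLH hdec (isTypeIBlowup_of_level hrate)

/-- The integer ladder: all positive real rungs hold iff all rungs of level `n + 1`, `n : ℕ`, hold
(by monotonicity, rung `⌈C⌉₊ + 1` implies rung `C`; bookkeeping on Leray's rate (3.9) with a
parameter in place of `A`). [cite: Leray1934, §19 (3.9) p. 224] -/
theorem forall_collapseReynoldsNoBlowup_iff_nat :
    (∀ C : ℝ, 0 < C → CollapseReynoldsNoBlowup C) ↔
      ∀ n : ℕ, CollapseReynoldsNoBlowup ((n : ℝ) + 1) := by
  constructor
  · intro h n
    exact h _ (by positivity)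
  · intro h C _
    refine (h ⌈C⌉₊).anti ?_
    exact (Nat.le_ceil C).trans (le_add_of_nonneg_right zero_le_one)

end Literature.Analysis.FluidPDE
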